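import Summits.AtomisticToContinuum.BoseEinsteinCondensation.Theorems.BECCutLineWeakDisorderGroundStateRigidityStubSectorExclusionAux3
import HarnessLib

/-!
# Crux `GroundStateRigidity` (stmt-AtomisticToContinuum-9072), line `Sketch` (skeleton v9):
# the registered stub `stub_sectorExclusion` (Stub C — sector exclusion)

Supports (does not close) stmt-AtomisticToContinuum-9072; stub `stub_sectorExclusion` of line
Sketch (lead c5). **Components of the free region with a permanent member carry no ground-state
mass once the confinement cost beats the insertion cost.** Hard-core class (`v = ⊤` on `[0, b]`,
measurable), `N + 1` bosons in the Dirichlet box `Λ_L`. GIVEN the neighbour-Poincaré inequality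
at constant `c` (hypothesis; Stub A of the line) and the gap `E₀(N+1, L) + g ≤ E₀(N, L) + c/b²`
with `g > 0`, every closed-form ground state `Ψ` vanishes a.e. on
`U' = {X ∈ F : some label i has, at every configuration of the component of X in F, a neighbour
within 2b}`, `F = {all pairs > b} ∩ Λ_L^{N+1}` the (open) free region.

## Proof (files `…StubSectorExclusionAux{,2,3}.lean` and this one)

1. (Aux) CLOPEN SURGERY: a finite-energy trial state `Φ` vanishes with its derivative off `F`
   (a.e. on the contact set since `v = ⊤` there, then everywhere on the open "escape" set by
   continuity, then on its closure `⊇ Fᶜ`; likewise for the continuous `fderiv`), so for every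
   union `T` of components of `F` (a "sector": `T` and `F ∖ T` are open) `T.indicator Φ.ψ` is
   `C¹` with `fderiv = T.indicator (fderiv Φ.ψ)`, and its energy density is `T.indicator e_Φ`.
2. (Aux2) SECTORS: `pm X` = the finset of permanent members of the component of `X`; it is
   constant along components, so `{X ∈ F | pm X ∈ 𝒜}` is open for every family `𝒜`; relabelling
   gives `j ∈ pm (X ∘ σ) ↔ σ j ∈ pm X`, whence `{#pm = m}` is `S_{N+1}`-invariant and
   `{i ∈ pm, #pm = m}` is invariant under the permutations fixing `i`; and the counting identities
   `∑ᵢ 1_{i ∈ pm, #pm = m} = m 1_{#pm = m}`, `1_{U'} = ∑_{m ≥ 1} 1_{#pm = m}`.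
3. (Aux3) FLOORS: `E₀(N+1) ∫_{#pm=0} |Φ|² ≤ ∫_{#pm=0} e_Φ` (variational principle for the
   symmetric sector state); `(E₀(N) + c/b²) ∫_T |Φ|² ≤ ∫_T e_Φ` for `T = {i ∈ pm, #pm = m}`
   (Dirichlet group extraction `groundStateEnergy_mul_le_setLIntegral_group` of the `N`
   particles `≠ i`, plus the Poincaré hypothesis for particle `i`, which always has a neighbour
   within `2b` on `T`); summing over `i` and `m` and using the gap:
   `E₀(N+1) + g ∫_{U'} |Φ|² ≤ energy v Φ` for EVERY trial state (`SectorExclusion.key`).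
4. (here) CLOSED-FORM LIMIT: for a ground state `Ψ`, `q̄[Ψ] = E₀(N+1) < ⊤`, so for `ε > 0`
   there are trial states `Φₙ → Ψ` in `L²` with energies `< E₀(N+1) + ε` along a subsequence;
   then `g ∫_{U'} |Φₙ|² < ε` and `∫_{U'} |Ψ|² ≤ 2 ∫ |Φₙ - Ψ|² + 2 ∫_{U'} |Φₙ|²`, so in the limit
   `g ∫_{U'} |Ψ|² ≤ 2ε`; hence `∫_{U'} |Ψ|² = 0` (`g > 0`; `g < ⊤` w.l.o.g. by `g ↦ min g 1`).

References: Reed–Simon IV §XIII.12 (ground states as minimisers of the closed form); LSSY 2005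
(2.52)–(2.53) (dropping interactions and extracting groups, `v ≥ 0`).
-/

noncomputable section

open MeasureTheory Filter Set Metric
open scoped ENNReal NNReal Topology

namespace Summit.AtomisticToContinuum.BoseEinsteinCondensation.Theorems.GroundStateRigidity

open Literature.MathematicalPhysics.QuantumManyBody.BoseGas

namespace SectorExclusion

variable {N : ℕ} {L b : ℝ} {v : ℝ → ℝ≥0∞}

/-- **The ground state carries no mass on the crowded sector.** Under the hypotheses of Stub C,
`∫_{U'} |Ψ|² = 0` for every ground state `Ψ`: along near-minimising approximants `Φₙ → Ψ` in `L²`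
(which exist as `q̄[Ψ] = E₀(N+1, L) < ⊤`) the key inequality gives `g ∫_{U'} |Φₙ|² < ε`, and
`∫_{U'} |Ψ|² ≤ 2 ∫|Φₙ - Ψ|² + 2 ∫_{U'} |Φₙ|²`. [cite: ReedSimonIV1978, §XIII.12 Thm XIII.46] -/
theorem lintegral_crowded_groundState_eq_zero (hb : 0 < b) (hv : Measurable v)
    (hcore : ∀ s : ℝ, s ∈ Set.Icc 0 b → v s = ⊤) {c : ℝ} {g : ℝ≥0∞} (hg : 0 < g)
    (hP : ∀ (i : Fin (N + 1)) (φ : Config (N + 1) → ℂ), ContDiff ℝ 1 φ →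
        (∀ X : Config (N + 1), (∃ j j' : Fin (N + 1), j ≠ j' ∧ dist (X j) (X j') ≤ b) → φ X = 0) →
        ENNReal.ofReal (c / b ^ 2) *
            ∫⁻ X, {Y : Config (N + 1) | ∃ j : Fin (N + 1), j ≠ i ∧ dist (Y i) (Y j) ≤ 2 * b}.indicator
              (fun Y => (‖φ Y‖₊ : ℝ≥0∞) ^ 2) X ≤
          ∫⁻ X, ∑ k : Fin 3,
            (‖fderiv ℝ φ X (Pi.single i (EuclideanSpace.single k (1 : ℝ)))‖₊ : ℝ≥0∞) ^ 2)
    (hgap : groundStateEnergy v (N + 1) L + g ≤ groundStateEnergy v N L + ENNReal.ofReal (c / b ^ 2))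
    {Ψ : Config (N + 1) → ℂ} (hΨ : IsGroundState v L Ψ) :
    ∫⁻ X, (sector (N + 1) L b {s | s.card = 0}ᶜ).indicator (fun Y => (‖Ψ Y‖₊ : ℝ≥0∞) ^ 2) X = 0 := by
  set U := sector (N + 1) L b {s : Finset (Fin (N + 1)) | s.card = 0}ᶜ with hU
  have hUm : MeasurableSet U := measurableSet_sector _
  have hE₁t : groundStateEnergy v (N + 1) L ≠ ⊤ := hΨ.groundStateEnergy_ne_top
  -- w.l.o.g. `g` is finite
  set g' : ℝ≥0∞ := min g 1 with hg'
  have hg'0 : g' ≠ 0 := (lt_min hg one_pos).ne'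
  have hg't : g' ≠ ⊤ := ne_top_of_le_ne_top ENNReal.one_ne_top (min_le_right _ _)
  have hgap' : groundStateEnergy v (N + 1) L + g' ≤
      groundStateEnergy v N L + ENNReal.ofReal (c / b ^ 2) :=
    (add_le_add_right (min_le_left g 1) _).trans hgap
  have hkey : ∀ Φ : TrialState (N + 1) L, groundStateEnergy v (N + 1) L +
      g' * ∫⁻ X, U.indicator (fun Y => (‖Φ.ψ Y‖₊ : ℝ≥0∞) ^ 2) X ≤ energy v Φ :=
    fun Φ => key hb hv hcore hP hgap' Φ
  set M := ∫⁻ X, U.indicator (fun Y => (‖Ψ Y‖₊ : ℝ≥0∞) ^ 2) X with hM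
  suffices h : ∀ ε : ℝ≥0, 0 < ε → g' * M ≤ (ε : ℝ≥0∞) by
    have h0 : g' * M ≤ 0 :=
      ENNReal.le_of_forall_pos_le_add fun ε hε _ => by simpa using h ε hε
    exact (mul_eq_zero.1 (le_antisymm h0 (zero_le))).resolve_left hg'0
  intro ε hε
  have hε0 : (ε : ℝ≥0∞) ≠ 0 := by exact_mod_cast hε.ne'
  have hε2 : (0 : ℝ≥0∞) < ε / 2 := ENNReal.half_pos hε0
  -- near-minimising approximants
  have hlt : closedEnergy v L Ψ < groundStateEnergy v (N + 1) L + ε / 2 := by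
    rw [hΨ.closedEnergy_eq]
    exact ENNReal.lt_add_right hE₁t hε2.ne'
  obtain ⟨Φ, hΦ⟩ := iInf_lt_iff.1 hlt
  obtain ⟨hΦΨ, hlim⟩ := iInf_lt_iff.1 hΦ
  have hfreq : ∃ᶠ n in atTop, energy v (Φ n) < groundStateEnergy v (N + 1) L + ε / 2 :=
    frequently_lt_of_liminf_lt (h := hlim)
  obtain ⟨φ, hφ, hφE⟩ := extraction_of_frequently_atTop hfreq
  have hle : ∀ n, g' * M ≤ 2 * g' * (∫⁻ X, (‖(Φ (φ n)).ψ X - Ψ X‖₊ : ℝ≥0∞) ^ 2) + ε := by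
    intro n
    have h1 := VanishOffFree.setLIntegral_le_of_trialState hΨ.measurable (Φ (φ n)) U
    rw [← lintegral_indicator hUm, ← lintegral_indicator hUm] at h1
    have h2 : g' * ∫⁻ X, U.indicator (fun Y => (‖(Φ (φ n)).ψ Y‖₊ : ℝ≥0∞) ^ 2) X < ε / 2 :=
      lt_of_add_lt_add_left ((hkey (Φ (φ n))).trans_lt (hφE n))
    calc g' * M ≤ g' * (2 * (∫⁻ X, (‖(Φ (φ n)).ψ X - Ψ X‖₊ : ℝ≥0∞) ^ 2) +
          2 * ∫⁻ X, U.indicator (fun Y => (‖(Φ (φ n)).ψ Y‖₊ : ℝ≥0∞) ^ 2) X) :=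
        mul_le_mul_right h1 _
      _ = 2 * g' * (∫⁻ X, (‖(Φ (φ n)).ψ X - Ψ X‖₊ : ℝ≥0∞) ^ 2) +
          2 * (g' * ∫⁻ X, U.indicator (fun Y => (‖(Φ (φ n)).ψ Y‖₊ : ℝ≥0∞) ^ 2) X) := by ring
      _ ≤ 2 * g' * (∫⁻ X, (‖(Φ (φ n)).ψ X - Ψ X‖₊ : ℝ≥0∞) ^ 2) + 2 * (ε / 2) :=
        add_le_add_right (mul_le_mul_right h2.le 2) _
      _ = _ := by rw [ENNReal.mul_div_cancel two_ne_zero ENNReal.ofNat_ne_top]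
  have ht : Tendsto (fun n => 2 * g' * (∫⁻ X, (‖(Φ (φ n)).ψ X - Ψ X‖₊ : ℝ≥0∞) ^ 2) + ε) atTop
      (𝓝 (2 * g' * 0 + ε)) :=
    (ENNReal.Tendsto.const_mul (hΦΨ.comp hφ.tendsto_atTop)
      (Or.inr (ENNReal.mul_ne_top ENNReal.ofNat_ne_top hg't))).add tendsto_const_nhds
  rw [mul_zero, zero_add] at ht
  exact ge_of_tendsto' ht hle

/-- **The ground state vanishes a.e. on the crowded sector** (a.e. form of
`lintegral_crowded_groundState_eq_zero`). [cite: ReedSimonIV1978, §XIII.12 Thm XIII.46] -/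
theorem ae_eq_zero_on_crowded (hb : 0 < b) (hv : Measurable v)
    (hcore : ∀ s : ℝ, s ∈ Set.Icc 0 b → v s = ⊤) {c : ℝ} {g : ℝ≥0∞} (hg : 0 < g)
    (hP : ∀ (i : Fin (N + 1)) (φ : Config (N + 1) → ℂ), ContDiff ℝ 1 φ →
        (∀ X : Config (N + 1), (∃ j j' : Fin (N + 1), j ≠ j' ∧ dist (X j) (X j') ≤ b) → φ X = 0) →
        ENNReal.ofReal (c / b ^ 2) *
            ∫⁻ X, {Y : Config (N + 1) | ∃ j : Fin (N + 1), j ≠ i ∧ dist (Y i) (Y j) ≤ 2 * b}.indicator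
              (fun Y => (‖φ Y‖₊ : ℝ≥0∞) ^ 2) X ≤
          ∫⁻ X, ∑ k : Fin 3,
            (‖fderiv ℝ φ X (Pi.single i (EuclideanSpace.single k (1 : ℝ)))‖₊ : ℝ≥0∞) ^ 2)
    (hgap : groundStateEnergy v (N + 1) L + g ≤ groundStateEnergy v N L + ENNReal.ofReal (c / b ^ 2))
    {Ψ : Config (N + 1) → ℂ} (hΨ : IsGroundState v L Ψ) :
    ∀ᵐ X : Config (N + 1), X ∈ sector (N + 1) L b {s | s.card = 0}ᶜ → Ψ X = 0 := by
  have hm : Measurable ((sector (N + 1) L b {s | s.card = 0}ᶜ).indicator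
      fun Y => (‖Ψ Y‖₊ : ℝ≥0∞) ^ 2) :=
    ((hΨ.measurable.nnnorm.coe_nnreal_ennreal).pow_const 2).indicator (measurableSet_sector _)
  have h := (lintegral_eq_zero_iff hm).1
    (lintegral_crowded_groundState_eq_zero hb hv hcore hg hP hgap hΨ)
  filter_upwards [h] with X hX hXU
  rw [Pi.zero_apply, indicator_of_mem hXU] at hX
  simpa using hX

end SectorExclusion

/-! ### The stub -/

open SectorExclusion in
/-- **Stub `stub_sectorExclusion` of line `Sketch` (Stub C) — sector exclusion: components with
a permanent member carry no ground-state mass once the confinement cost beats the insertion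
cost.** Hard-core class (`v = ⊤` on `[0, b]`, measurable), `N + 1` bosons in `Λ_L`. GIVEN the
neighbour Poincaré inequality at some constant `c > 0` (hypothesis) and the GAP
`E₀(N+1, L) + g ≤ E₀(N, L) + c/b²` for some `g > 0`, every closed-form ground state vanishes
a.e. on `U' = {X ∈ F : some label i has, at EVERY configuration of the component of X in F, a
neighbour within 2b}`, `F = {all pairs > b} ∩ Λ^{N+1}`. Proof: clopen `C¹` surgery of
finite-energy trial states along sectors of `F`, the fibrewise floor `E₀(N, L)` for the `N`
particles `≠ i` (`groundStateEnergy_mul_le_setLIntegral_group`) plus the Poincaré hypothesis for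
the permanent member `i`, `m`-counting over the never-lonely labels, the variational floor
`E₀(N+1, L)` on the complement, and the closed-form limit through near-minimising approximants
(`SectorExclusion.key`, `SectorExclusion.ae_eq_zero_on_crowded`).
[cite: ReedSimonIV1978, §XIII.12 Thm XIII.46; LSSY2005, (2.52)–(2.53)] -/
theorem stub_sectorExclusion :
    ∀ (N : ℕ) (v : ℝ → ℝ≥0∞) (L b c : ℝ) (g : ℝ≥0∞), 0 < L → 0 < b → 0 < c → 0 < g → Measurable v →
      (∀ s : ℝ, s ∈ Set.Icc 0 b → v s = ⊤) →
      (∀ (i : Fin (N + 1)) (φ : Config (N + 1) → ℂ), ContDiff ℝ 1 φ →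
        (∀ X : Config (N + 1), (∃ j j' : Fin (N + 1), j ≠ j' ∧ dist (X j) (X j') ≤ b) → φ X = 0) →
        ENNReal.ofReal (c / b ^ 2) *
            ∫⁻ X, {Y : Config (N + 1) | ∃ j : Fin (N + 1), j ≠ i ∧ dist (Y i) (Y j) ≤ 2 * b}.indicator
              (fun Y => (‖φ Y‖₊ : ℝ≥0∞) ^ 2) X ≤
          ∫⁻ X, ∑ k : Fin 3,
            (‖fderiv ℝ φ X (Pi.single i (EuclideanSpace.single k (1 : ℝ)))‖₊ : ℝ≥0∞) ^ 2) →
      groundStateEnergy v (N + 1) L + g ≤ groundStateEnergy v N L + ENNReal.ofReal (c / b ^ 2) →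
      ∀ Ψ : Config (N + 1) → ℂ, IsGroundState v L Ψ →
        ∀ᵐ X : Config (N + 1),
          X ∈ {X : Config (N + 1) |
              X ∈ {Z : Config (N + 1) | Z ∈ boxN (N + 1) L ∧
                    ∀ i j : Fin (N + 1), i ≠ j → b < dist (Z i) (Z j)} ∧
              ∃ i : Fin (N + 1), ∀ Y ∈ connectedComponentIn
                  {Z : Config (N + 1) | Z ∈ boxN (N + 1) L ∧
                    ∀ i j : Fin (N + 1), i ≠ j → b < dist (Z i) (Z j)} X,
                ∃ j : Fin (N + 1), j ≠ i ∧ dist (Y i) (Y j) ≤ 2 * b} →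
            Ψ X = 0 := by
  intro N v L b c g _ hb _ hg hv hcore hP hgap Ψ hΨ
  filter_upwards [ae_eq_zero_on_crowded hb hv hcore hg hP hgap hΨ] with X hX hXU
  exact hX ((mem_sector_crowded_iff X).2 hXU)

end Summit.AtomisticToContinuum.BoseEinsteinCondensation.Theorems.GroundStateRigidity

end
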